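import Summits.KontsevichZagierPeriods.KontsevichZagierPeriods.Theorems.SoloBlindTanHalf
import HarnessLib

/-!
# Cyclic bidiagonal determinants in every dimension

For `a b : Fin (n+2) → ℝ` let `M(a,b)` be the matrix whose row `i` carries `aᵢ` in column `i` and
`bᵢ` in column `i + 1` (indices mod `n + 2`).  Then

`det M(a,b) = ∏ᵢ aᵢ − (−1)ⁿ ∏ᵢ bᵢ`

(`det_cycMatrix`).  Proof: in the Leibniz expansion a permutation `τ` contributes only if every
`τ i ∈ {i, i − 1}`; such a `τ` is the identity or the backward rotation `i ↦ i − 1`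
(`perm_eq_one_or_eq_finRotate_inv`), whose sign is `(−1)ⁿ⁺¹`.

This is the Jacobian determinant of the cyclic tangent chart in dimension `n + 2`
(`SoloBlindCycChart`), generalising `det_cyclicBidiag` (`SoloBlindTanHalf`, dimension `4`).
-/

noncomputable section

namespace Summit.KontsevichZagierPeriods.KontsevichZagierPeriods.Theorems

open Finset

namespace SoloBlind

variable {n : ℕ}

/-- The backward rotation: `(finRotate (n+2))⁻¹ i = i - 1`. -/
theorem finRotate_inv_apply (i : Fin (n + 2)) : (finRotate (n + 2))⁻¹ i = i - 1 := by
  rw [Equiv.Perm.inv_def, Equiv.symm_apply_eq, finRotate_apply, sub_add_cancel]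

/-- In `Fin (n+2)`, `i - 1 ≠ i`. -/
theorem sub_one_ne_self (i : Fin (n + 2)) : i - 1 ≠ i := fun h =>
  one_ne_zero (sub_eq_self.mp h)

/-- **A permutation with every `τ i ∈ {i, i-1}` is `1` or the backward rotation.** -/
theorem perm_eq_one_or_eq_finRotate_inv (τ : Equiv.Perm (Fin (n + 2)))
    (h : ∀ i, τ i = i ∨ τ i = i - 1) : τ = 1 ∨ τ = (finRotate (n + 2))⁻¹ := by
  by_cases h1 : ∀ i, τ i = i
  · exact Or.inl (Equiv.ext fun i => by simpa using h1 i)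
  right
  push Not at h1
  obtain ⟨i₀, hi₀⟩ := h1
  set ρ : Equiv.Perm (Fin (n + 2)) := (finRotate (n + 2))⁻¹ with hρ
  have hρi : ∀ i, ρ i = i - 1 := finRotate_inv_apply
  have hρne : ∀ i, ρ i ≠ i := fun i => by rw [hρi]; exact sub_one_ne_self i
  have h0 : τ i₀ = ρ i₀ := by rw [hρi]; exact (h i₀).resolve_left hi₀
  have step : ∀ j, τ j = ρ j → τ (ρ j) = ρ (ρ j) := by
    intro j hj
    rcases h (ρ j) with h' | h'
    · exact absurd (τ.injective (h'.trans hj.symm)) (hρne j)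
    · rw [h', hρi (ρ j)]
  have key : ∀ m : ℕ, τ ((ρ ^ m) i₀) = ρ ((ρ ^ m) i₀) := by
    intro m
    induction m with
    | zero => simpa using h0
    | succ m ih =>
      rw [pow_succ', Equiv.Perm.mul_apply]
      exact step _ ih
  have hcyc : ρ.IsCycle := isCycle_finRotate.inv
  refine Equiv.ext fun i => ?_
  obtain ⟨m, hm⟩ := hcyc.exists_pow_eq (hρne i₀) (hρne i)
  rw [← hm]
  exact key m

/-- **The cyclic bidiagonal matrix**: row `i` has `aᵢ` in column `i` and `bᵢ` in column `i+1`. -/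
def cycMatrix (a b : Fin (n + 2) → ℝ) : Matrix (Fin (n + 2)) (Fin (n + 2)) ℝ :=
  fun i j => (if j = i then a i else 0) + (if j = i + 1 then b i else 0)

/-- Entries of the cyclic bidiagonal matrix. -/
theorem cycMatrix_apply (a b : Fin (n + 2) → ℝ) (i j : Fin (n + 2)) :
    cycMatrix a b i j = (if j = i then a i else 0) + (if j = i + 1 then b i else 0) := rfl

/-- The Leibniz term of a permutation outside `{1, ρ}` vanishes. -/
theorem prod_cycMatrix_eq_zero (a b : Fin (n + 2) → ℝ) {τ : Equiv.Perm (Fin (n + 2))}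
    (h1 : τ ≠ 1) (h2 : τ ≠ (finRotate (n + 2))⁻¹) : ∏ i, cycMatrix a b (τ i) i = 0 := by
  have h : ¬ ∀ i, τ i = i ∨ τ i = i - 1 := fun h =>
    (perm_eq_one_or_eq_finRotate_inv τ h).elim h1 h2
  push Not at h
  obtain ⟨i, hi, hi'⟩ := h
  refine prod_eq_zero (mem_univ i) ?_
  have hne1 : i ≠ τ i := fun e => hi e.symm
  have hne2 : i ≠ τ i + 1 := fun e => hi' (eq_sub_of_add_eq e.symm)
  simp [cycMatrix_apply, hne1, hne2]

/-- The Leibniz term of the identity is `∏ aᵢ`. -/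
theorem prod_cycMatrix_one (a b : Fin (n + 2) → ℝ) :
    ∏ i, cycMatrix a b ((1 : Equiv.Perm (Fin (n + 2))) i) i = ∏ i, a i := by
  refine prod_congr rfl fun i _ => ?_
  have hne : i ≠ i + 1 := fun e => (sub_one_ne_self (i + 1)) (by rw [add_sub_cancel_right, ← e])
  simp [cycMatrix_apply, hne]

/-- The Leibniz term of the backward rotation is `∏ bᵢ`. -/
theorem prod_cycMatrix_finRotate_inv (a b : Fin (n + 2) → ℝ) :
    ∏ i, cycMatrix a b ((finRotate (n + 2))⁻¹ i) i = ∏ i, b i := by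
  have h : ∀ i, cycMatrix a b ((finRotate (n + 2))⁻¹ i) i = b ((finRotate (n + 2))⁻¹ i) := by
    intro i
    rw [finRotate_inv_apply, cycMatrix_apply]
    have hne : i ≠ i - 1 := fun e => sub_one_ne_self i e.symm
    simp [hne, sub_add_cancel]
  simp_rw [h]
  exact Equiv.prod_comp _ b

/-- **`det M(a,b) = ∏ aᵢ − (−1)ⁿ ∏ bᵢ`.** -/
theorem det_cycMatrix (a b : Fin (n + 2) → ℝ) :
    (cycMatrix a b).det = ∏ i, a i - (-1) ^ n * ∏ i, b i := by
  have hne : (1 : Equiv.Perm (Fin (n + 2))) ≠ (finRotate (n + 2))⁻¹ := by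
    intro e
    have h0 := congrArg (fun τ : Equiv.Perm (Fin (n + 2)) => τ 0) e
    simp only [Equiv.Perm.one_apply, finRotate_inv_apply] at h0
    exact sub_one_ne_self 0 h0.symm
  rw [Matrix.det_apply', Fintype.sum_eq_add 1 (finRotate (n + 2))⁻¹ hne fun τ hτ => by
    rw [prod_cycMatrix_eq_zero a b hτ.1 hτ.2, mul_zero]]
  have hs : n + 2 - 1 = n + 1 := rfl
  rw [prod_cycMatrix_one, prod_cycMatrix_finRotate_inv, Equiv.Perm.sign_one,
    Equiv.Perm.sign_inv, sign_finRotate, hs]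
  simp only [Units.val_one, Int.cast_one, one_mul, Units.val_pow_eq_pow_val, Units.val_neg,
    Int.cast_pow, Int.cast_neg, Int.cast_one]
  ring

end SoloBlind

end Summit.KontsevichZagierPeriods.KontsevichZagierPeriods.Theorems
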